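import Summits.BirchSwinnertonDyer.BirchSwinnertonDyer.Theorems.PrintX11aNonSurjEulerHalfOfMu
import Summits.BirchSwinnertonDyer.BirchSwinnertonDyer.Theorems.PrintX11aNonSurjMuAnHardDefs
import Summits.BirchSwinnertonDyer.BirchSwinnertonDyer.Theorems.PrintX11aUpperNonSurjThreeMultDivisibilityAtOfConjA
import Summits.BirchSwinnertonDyer.BirchSwinnertonDyer.Theorems.PrintX11aUpperNonSurjThreeConjAOfMuAn
import Summits.BirchSwinnertonDyer.BirchSwinnertonDyer.Theorems.PrintX11aMuCertGivesConjA
import Summits.BirchSwinnertonDyer.BirchSwinnertonDyer.Theorems.PrintX11aUpperNonSurjThreeMuAnHardThreeOfMazur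
import Summits.BirchSwinnertonDyer.BirchSwinnertonDyer.Theorems.PrintX11aUpperNonSurjThreeOfNineFacts
import Summits.BirchSwinnertonDyer.BirchSwinnertonDyer.Theorems.PrintX11aUpperNonSurjThreeOfGreenbergRankZero
import Literature.NumberTheory.EllipticCurves.Rank1Residual.MuLambdaCarriers
import HarnessLib

/-!
# Line «finemu3» for the child crux U3 = `PrintX11a.UpperNonSurjThree` (item stmt-BirchSwinnertonDyer-20613)
# of route `route-BirchSwinnertonDyer-PrintX11a` — ideator seat bsd-idea-6 (lens «decomp»), 2026-08-28

BSD is not proved by any of this; nothing is asserted about any curve; the `sorry`s below are exactly the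
registered stubs (r8: ONE cite stub; r7: seven); each composition (`UpperNonSurjThree_of`, `UpperNonSurjThree_of_muRoad`) is a real proof.

THE LEVER (different from the registered lines «birth» / «hardlocus3», whose open input is the ANALYTIC
`μ = 0` certificate of the Mazur–Tate–Teitelbaum function): Coates–Sujatha's statement (A) — the dual FINE
Selmer group `X₀(E/ℚ_∞)` is finitely generated over `ℤ_p` — replaces Kato's big-image hypothesis (12.5.2) at
the ONE height-one prime `(p)` of `Λ` where the Euler-system argument needs it (barrier
`Literature.Barriers.BirchSwinnertonDyer.EulerSystemBigImageBarrier`, evasion (i)): from Kato's §17.13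
sequence `P → X → X₀ → 0` at `p ∥ N` (typed: `Kato2004.exists_multDivisibilityInputs_fine`, the p. 280
image clause «`col(loc Z)` and `Λ·G₁` agree at every height-one prime», `ι G₁ = ϖ·L`) one gets
`μ(X) ≤ μ(X₀) + μ(ϖ·L)`; with (A), `μ(X₀) = 0`, so `μ(X) ≤ μ(ϖ·L)`, and together with Kato's `⊗ℚ`
divisibility (tree theorem `MultKatoRat.katoMultiplicativeDivisibilityRat_of_facts_odd`) this is the
INTEGRAL divisibility `ϖ·L ∈ char_Λ X` = `X11b.MultDivisibilityAt` — no analytic `μ = 0`, no image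
hypothesis. On the U3 domain the image is `3Nn`/`3Ns` (order 16/8, prime to 3), so `E[3] = Ind_M^ℚ χ` from
the Cartan field `M` (Shapiro: `H¹(ℚ, E[3]) = H¹(M, χ)`), Deo–Ray–Sujatha's (c1) is automatic and (A) is a
FIRST-LAYER class-group certificate on `ℚ(E[3])` (degree ≤ 16) per pair
(`DeoRaySujatha2023.thm39_fineSelmerDual_moduleFinite_of_homTrivial_divisionField`; the cell bsd-f3-mu's
`SmallImageMu.FirstLayer*Criterion` nodes), congruence-invariant in `E[3]` (`LimSujatha2018`), and class-wide
an instance of Iwasawa's `μ = 0` conjecture for these `D₄`/`SD₁₆` fields (Coates–Sujatha Thm. 3.4) — OPEN.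

Stubs (4): `stub_conjA_three` (NEW open input on this crux, load-bearing for the (A)-road),
`stub_multDivisibilityAt_of_conjA` (the TRANSFER at a multiplicative odd prime, `p`-generic, provable modulo the displayed
named facts: the `(A)`-variant of `X11b.MultMu.mu_eq_zero_of_multFine`, multiplicative copy of the LANDED good-ordinary
`SmallImageMu.katoDivisibilityAt_of_conjAAt_F1`), `stub_pubFactsAn` (= K2's item 19949 `ErratumRoadFive.KatoTwinFactsFiveAn`
BY NAME, shared), and — so that registering this skeleton costs the print-x11a cell NOTHING — the μ-road's stub
`stub_muAnHardThree` (= `Theorems.X11aNonSurjMuAnHardThree`, verbatim from «hardlocus3») with its own composition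
`UpperNonSurjThree_of_muRoad` (verbatim from «hardlocus3»).  TWO INDEPENDENT ROADS to the same fixed crux are thus registered on
the item: `UpperNonSurjThree_of` ((A)-road: stubs 1–3) and `UpperNonSurjThree_of_muRoad` (μ-road: stubs 4 + 3); whichever stub set
lands first closes the crux; no stub of one road is used by the other.

LEAD r8 (gen 21 = prover-bsd-line-x11a-p1-g21-0, 2026-08-29T14:3xZ): **RESTUB «VARIANT-N» per director-bsd g18's RESTUB SHAPE OF RECORD
(ladder-directors/REQUESTS.md (390)(i)–(iii), cell INBOX 2026-08-29T12:57:06Z; (385)(2)/(387) RESTUB WAVE, x11a turn).**  The registry REFUSES a bare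
Literature named fact as a hypothesis of a registered `<Crux>_of` (`skeleton.extra-hypothesis`; machine-checked for this cell by width seat er5-p2 g25's
probes A–D, evidence #60 on 19064), so «every print fact a skeleton needs = a conjunct of ONE declared cite stub with the Literature decls BY NAME inside,
[CITE-ONLY — never a proof target, never benched, never counted]».  r8 therefore MERGES r7's SEVEN single-fact stubs into ONE declared cite stub
`stub_printInputsUpperThree : G104 ∧ G103 ∧ (∀ W p, p ≠ 2 → greenberg_stevens) ∧ Kato2004.thm12_4 ∧ exists_isNewformOf ∧ …nonsplit_contra ∧ …split_contra ∧
…fine_contra ∧ mazur_not_dvd_maninConstant_of_odd` (NINE named facts; conjunct order = p672149's argument order) and keeps the seven r7 NAMES as sorry-free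
PROJECTION THEOREMS (`stub_newformFact := stub_printInputsUpperThree.2.2.2.2.1`, …), so `sevenOfNine_of_stubs`, the composition `UpperNonSurjThree_of` and
every conditional theorem below are BYTE-IDENTICAL to r7.  REPORT tokens ((390), one per print-touched stub): `stub_newformFact` PURE-CITE · `stub_maninOddFact`
PURE-CITE · `stub_greenbergStevensOdd` PURE-CITE · `stub_greenbergSplitRankZero` PURE-CITE · `stub_greenbergNonsplitRankZero` PURE-CITE · `stub_kato124Fact` PURE-CITE ·
`stub_katoContraInputs` PURE-CITE (all seven → the cite stub); MIXED none; CONTENT none.  Registered stubs after r8: ONE (`stub_printInputsUpperThree`, CITE-ONLY,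
9 conjuncts); sorries 7 → 1; named published facts on the line 9 (unchanged); research statements 0.  READING per (390)(iii): the line's ONLY open stub is
the cite stub ⇒ U3 reads **«closed mod print: exists_isNewformOf, mazur_not_dvd_maninConstant_of_odd, greenberg_stevens (odd p),
Greenberg1999.thm41Analogue_charValue_rankZero_split_baseChange_anyPrime, Greenberg1999.thm41Analogue_charValue_rankZero_numberField, Kato2004.thm12_4,
Kato2004.exists_multDivisibilityInputs_{nonsplit,split,fine}_contra»** on the director's mod-print counter — the LEDGER ITEM 20613 STAYS OPEN (no `_holds`
exists for any of the nine; bench wave 2026-08-29T11:5xZ: katoContraInputs ∕ greenbergSplitRankZero BLOCKED); no pretence of closure.  W-81′ turnkey unchanged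
(p672149 `upperNonSurjThree_of_greenberg_of_sevenFacts C_G104 C_G103 C_GSodd C_Kato124 C_19382 C_V′ C_VI′ C_XI′ C_Mazur41`; a planner bundle item would feed
it by projections).  Nothing provable added or removed; nothing is asserted about any curve; BSD is not proved by any of this.

LEAD r7 (gen 12 = prover-bsd-line-x11a-p1-g12-0, 2026-08-28T22:1xZ): **U3's nine facts ONE PER STUB, Greenberg-typed.**  The one event since g11 is the
INPUTS desk's grading (pub/bsd-wall/bsd-inputs/INPUTS-LIST-2-ADDENDUM-37.md §G, 21:38:37Z; REF g21 READ ✓ 21:38:53Z): Greenberg's two rank-`0`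
"analogue of theorem 4.1" facts (LNM 1716 §4) are REGISTERED rows **G103** `Greenberg1999.thm41Analogue_charValue_rankZero_numberField` ∕ **G104**
`Greenberg1999.thm41Analogue_charValue_rankZero_split_baseChange_anyPrime` (D-audit FAITHFUL), they DOMINATE Stein–Wuthrich 2013 Thm. 6.1 ×2 on this
rank-`0` class (SW 6.1 is typed for every rank; at `r ≥ 1` it rests on Jones 1989 Thm. 3.1, primary UNHELD; its `r = 0` slices are tree THEOREMS from
exactly G104 ∕ G103, p662964 ∕ p664420), and the swap is «INPUTS-positive (−1 unheld XL print dependency, +0 named facts)».  U3's engine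
(`X11b.le_padicValRat_of_{nonsplit,split}_divisibility_rankZero_noGZK`, p622718) reads SW 6.1 only AFTER deriving `rank E(ℚ) = 0` from Kato's
divisibility by the control theorem, so the lead's `Theorems/PrintX11aUpperNonSurjThreeOfGreenbergRankZero.lean` (p672149 ✓, 22:01:47Z) re-issues the
engine and the crux BY NAME with `hJs hJn ↦ hGs hGn` (`Theorems.GreenbergRankZero.upperNonSurjThree_of_greenberg_of_sevenFacts`).  r7 registers
U3's nine facts in that currency and ONE PER STUB (the shape of U5's gl1cartan5 rev 5–8, REF POLICE EQUAL; each stub closes BY INSTANTIATION the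
moment its `_holds` lands; Kato §17.13 V′ ∕ VI′ ∕ XI′ — one paper section — stay one stub): `stub_newformFact : exists_isNewformOf` (= item 19382's
body; = U5 `stub_newform`, = L r19) ∣ `stub_maninOddFact : mazur_not_dvd_maninConstant_of_odd` (= U5 `stub_maninOdd`) ∣ `stub_greenbergStevensOdd`
(odd-prime GS, r6 slot 3 verbatim; = L r19) ∣ `stub_greenbergSplitRankZero` (G104; = L r19) ∣ `stub_greenbergNonsplitRankZero` (G103; = L r19) ∣
`stub_kato124Fact : Kato2004.thm12_4` ∣ `stub_katoContraInputs : …nonsplit_contra ∧ …split_contra ∧ …fine_contra`; composition `UpperNonSurjThree_of`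
through p672149.  The r6 road is KEPT in the tree as x11a-p2 g4's glue `Theorems.upperNonSurjThree_of_nineFacts_oddGS_glue` (p625569, hypothesis = the r6 text
verbatim) — a planner who files the SW-typed nine still closes U3 through it; r7 is a re-typing, not monotone: SW 6.1 ⇏ G103 ∕ G104.  PLANNER TURNKEY r7:
`UpperNonSurjThree_holds := Theorems.GreenbergRankZero.upperNonSurjThree_of_greenberg_of_sevenFacts C_G104 C_G103 C_GSodd C_Kato124 C_19382 C_V′ C_VI′
C_XI′ C_Mazur41` (or `…_of_nineFactsGreenberg_glue C_nine′` on ONE item with the Greenberg-typed conjunction).  Named facts 9 → 9; unheld print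
dependencies in the `_holds` cone −1.  Nothing of U3 beyond print remains; BSD is not proved by any of this.

LEAD r6 (gen 1, 2026-08-28T11:0xZ): **ONE registered stub, print-exact.**  x11a-p2 g4 found that r5's `stub_nineFactsAn` (= p624348's glue
hypothesis = the shape of 19949's conjunct 14) reads the exceptional-zero formula at EVERY prime, i.e. includes the `p = 2` instance that has no
printed proof (GS93: p ≥ 5; Kobayashi 2006 Cor. 4.2: odd p) — an input item filed with that text would contain an open statement — and landed the
odd-keyed glue `Theorems.upperNonSurjThree_of_nineFacts_oddGS_glue` (append to `Theorems/PrintX11aUpperNonSurjThreeOfNineFacts.lean`).  r6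
therefore registers `stub_nineFactsOddGS` (slot 3 = `∀ W p, p ≠ 2 → greenberg_stevens`) as the ONLY stub of the line, with composition
`UpperNonSurjThree_of` through that glue; `stub_pubFactsAn` (= 19949, same all-prime GS conjunct + γ-keyed Kato facts) is RETIRED from the
registered set — the r1–r4 roads through K2's bundle are kept as CONDITIONAL theorems `…(hF : KatoTwinFactsFiveAn)` (sorry-free history; g0's
p617007 is their landed form).  PLANNER TURNKEY (re-split of 20613, director GO 08:56:07Z): child := `stub_nineFactsOddGS`'s text VERBATIM
(x11a-p2 g4's item «UpperNonSurjThreeInputs», odd-GS slot), glue := `Summit.BirchSwinnertonDyer.BirchSwinnertonDyer.Theorems.upperNonSurjThree_of_nineFacts_oddGS_glue`.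
Nothing of U3 beyond print remains; BSD is not proved by any of this.

LEAD r5 (gen 1, 2026-08-28T10:5xZ): **A SECOND, SMALLER FACT ROAD IS REGISTERED.** Width seat bsd-line-x11a-p2 g3 reduced the published inputs
of the μ-road from the twenty-three conjuncts of 19949 to NINE print-exact named facts (p619657 → p621238 → p622037 → `Theorems/
PrintX11aUpperNonSurjThreeEngineWithoutGZK.lean`, `ClassX11a.upperNonSurjThree_body_of_nineFacts`): Stein–Wuthrich 6.1 ×2, Greenberg–Stevens,
Kato 12.4, modularity (`exists_isNewformOf`), Kato §17.13 V′ ∕ VI′ ∕ XI′ in the PRINT-EXACT `_contra` form (so rider R-48 leaves U3's cone, REF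
V43/V47), Mazur Cor. 4.1 — Wuthrich Cor. 18 and Greenberg 1.5 are DISCHARGED at the pair (tree theorems under Irr + Mazur), conjuncts 5/7/17 of
19949 derived, and Gross–Zagier–Kolyvagin replaced by the control theorem (`rank E(ℚ) = 0`, `#Ш[3^∞] < ∞` from the divisibility).  r5 registers
that bundle as `stub_nineFactsAn` (conjunction of the nine `def … : Prop` Literature facts, never «proved») with its own composition
`UpperNonSurjThree_of_nineFacts`, BESIDE `stub_pubFactsAn` (= item 19949, road r4, kept).  The two fact stubs are ALTERNATIVE complete roads
(planner: file ONE child — preferred (b) the nine-fact text verbatim (= `stub_nineFactsAn`'s statement; x11a-p2 g3's TURNKEY item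
`UpperNonSurjThreeInputs`), glue `Theorems.upperNonSurjThree_of_nineFacts_glue` (p624348, REF V52 PASS); or (a) 19949, glue p617007; or (a′) K2's
`KatoTwinFactsFiveAnContra` text if stepL files it — the nine facts are its conjuncts 12,13,14,18,6,19,20,23,9, a projection glue).  Nothing of U3
beyond print remains in either road; BSD is not proved by any of this.

LEAD r4 (2026-08-28T08:1xZ): **THE CRUX IS REDUCED TO K2's PUBLISHED-FACT BUNDLE.** Width seat bsd-line-x11a-p2 g2 landed
`Theorems/PrintX11aUpperNonSurjThreeMuAnHardThreeOfMazur.lean` (p614543): Greenberg's ANALYTIC μ₃ = 0 at a MULTIPLICATIVE 3 for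
every `E/ℚ` with `E[3]` irreducible (`MultThreeMuAn.muAnZeroAt_three_of_mult_of_irr`, Atkin–Lehner-extended orbit trick in
GL₂(ℤ[1/3]) + the winding theorem p613999, 0 named fact beyond Mazur 1978 Cor. 4.1) and `MultThreeMuAn.x11aNonSurjMuAnHardThree_of_mazur :
mazur_not_dvd_maninConstant_of_odd → Theorems.X11aNonSurjMuAnHardThree`.  Mazur's Manin-constant fact is CONJUNCT 9 of
`stub_pubFactsAn` (= item 19949), so in this file `stub_muAnHardThree`, `stub_conjA_hardThree` and `stub_conjA_three` are now
THEOREMS derived from `stub_pubFactsAn` (μ-hard from Manin; (A)-hard from μ-hard by the lead's p608976; (A)-whole from (A)-hard by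
x11a-p3's p609537), and EVERY composition below has exactly ONE `sorry` in its cone: `stub_pubFactsAn : Theses.ErratumRoadFive.KatoTwinFactsFiveAn`
— twenty-three statement-only named PUBLISHED facts (GZK, modularity ×3, Stein–Wuthrich 6.1 ×2, Greenberg–Stevens, Kato 12.4 /
§17.13 construction facts at p ∥ N (flags R-48 etc.), Greenberg 1999 1.5, Wuthrich Cor. 18, Mazur's Manin constant, Cha, …).  The crux
U3 holds MODULO 19949 in the kernel (`UpperNonSurjThree_of_pubFacts` below, hypothesis = the bundle); it does not close outright
because the bundle's conjuncts are `def … : Prop` facts without `_holds`.  BSD is not proved by any of this.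

LEAD r3 (2026-08-28T07:1xZ): the two (A)-stubs are EQUIVALENT modulo `stub_pubFactsAn` —
`stub_conjA_three_of_conjA_hardThree` below: off the hard sub-locus the pair is non-split with a unit special value, the
constant term of ϖ·L is then a unit (MTT §I.10, a_p = −1) and statement (A) follows OUTRIGHT from the facts by x11a-p3's landed
`ClassX11a.conjAAt_of_muAnHard_of_not_surj` (Theorems/PrintX11aMuCertGivesConjA.lean); so the registered open inputs of U3
are, up to 19949: ONE statement — (A) on the hard sub-locus — with the μ-road's `stub_muAnHardThree` as a sufficient stronger form.

LEAD r2 (2026-08-28T06:2xZ): ROAD DOMINANCE in the kernel — `stub_conjA_hardThree_of_muAnHardThree` below derives the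
(A)-hard stub's STATEMENT from the μ-road's stub `stub_muAnHardThree` and four conjuncts of `stub_pubFactsAn` (landed
`Theorems/PrintX11aUpperNonSurjThreeConjAOfMuAn.lean`, p608976: one unit coefficient of ϖ·L ⟹ Sel₀[p] finite ⟹ (A));
so `stub_conjA_hardThree` is the WEAKEST registered open input of U3 (⟸ `stub_conjA_three` trivially, ⟸
`stub_muAnHardThree` mod 19949), and the per-pair (A)-road has THREE kernel entries: the ♯0 criterion
(`ClassX11a.conjAAt_of_not_surj_of_sharpResidual_eq_zero`, -w2 p608099/p608370, fact-free), the Fukuda/CS/DRS class-group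
doors (-w2 p606688), and every μ^an-record (this edge).

LEAD RESHAPE r1 (bsd-line-x11a-p1, 2026-08-28, «(A) on the hard sub-locus»): a FIFTH registered stub
`stub_conjA_hardThree` = `stub_conjA_three` restricted to the HARD sub-locus {split at `p`} ∪ {`ord_p(L(E,1)/Ω_E) ≠ 0`}
(the same cut as the μ-road's `stub_muAnHardThree`), with a THIRD composition `UpperNonSurjThree_of_conjAHard`: on the
non-split unit-value sub-locus the landed `Theorems.x11a_missingUpperBoundAt_of_not_surj_of_nonsplit_of_unit_value` needs
neither (A) nor μ; elsewhere (A) ⟹ transfer ⟹ door.  Strictly fewer pairs than `stub_conjA_three` (census @3: the unit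
non-split pairs of the 12 known U3 pairs leave; the 7 HARD pairs stay); class-wide still an Iwasawa-μ statement (OPEN).
`stub_conjA_three` stays registered (whole-domain form; -w2's class form «⟸ CS05 Thm 3.4» targets it).

References: [CoatesSujatha2005] §3 statement (A), Thm. 3.4; [Kato2004Asterisque] Thm. 12.4 (3), 12.5 (3),
(14.9.3), §17.13 (pp. 279–280); [Wuthrich2014] Lemma 14 (p. 396), Prop. 15 (p. 397), Cor. 18 (p. 398);
[DeoRaySujatha2023] Thm. 3.8/3.9, Lemma 5.1; [LimSujatha2018] Prop. 3.2; [GreenbergLNM1716] Conj. 1.11.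
-/

set_option linter.dupNamespace false
set_option autoImplicit false

noncomputable section

open scoped Classical NumberField MatrixGroups ModularForm

open CongruenceSubgroup WeierstrassCurve Field
  Literature.NumberTheory.EllipticCurves
  Literature.NumberTheory.EllipticCurves.ModularForms
  Literature.NumberTheory.EllipticCurves.Rank1Residual
  Literature.NumberTheory.EllipticCurves.Rank1Residual.Typed
  Literature.NumberTheory.EllipticCurves.Wuthrich2014
  Literature.NumberTheory.EllipticCurves.SteinWuthrich2013
  Literature.NumberTheory.EllipticCurves.Greenberg1999
  Literature.NumberTheory.EllipticCurves.Kato2004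
  Summit.BirchSwinnertonDyer.Rank1Residual
  Summit.BirchSwinnertonDyer.Rank1Residual.X11b
  Summit.BirchSwinnertonDyer.BirchSwinnertonDyer

namespace Summit.BirchSwinnertonDyer.BirchSwinnertonDyer.Cruxes.UpperNonSurjThree.FineMu

/-! ## r8 ORDER: the ONE registered CITE stub (nine named facts, Greenberg-typed) and r7's seven single-fact names as its PROJECTIONS, then the discharged ∕ conditional stubs of r1–r6, then the compositions -/

/- r6: `stub_pubFactsAn : Theses.ErratumRoadFive.KatoTwinFactsFiveAn` (= K2's item 19949; the registered fact stub of r2–r5) is NO LONGER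
REGISTERED: its conjunct 14 reads Greenberg–Stevens at EVERY prime incl. `p = 2` (no printed proof; x11a-p2 g4), and three of its Kato §17.13
conjuncts are γ-keyed (rider R-48).  The 19949 road survives below as the CONDITIONAL theorems `…_of_pubFacts (hF : KatoTwinFactsFiveAn)`
(sorry-free; = g0's landed p617007). -/

/-- **stub (r8; ONE declared CITE stub — [CITE-ONLY — never a proof target, never benched, never counted]; director-bsd RESTUB SHAPE OF
RECORD (390)(i), 2026-08-29T12:57Z)**: the NINE print-exact statement-only named facts the composition `UpperNonSurjThree_of` consumes through the
lead's `Theorems.GreenbergRankZero.upperNonSurjThree_of_greenberg_of_sevenFacts` (p672149), as ONE conjunction with the Literature decls BY NAME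
inside, in p672149's argument order: (1) GREENBERG's rank-`0` formula at a SPLIT multiplicative prime, INPUTS row G104
`Greenberg1999.thm41Analogue_charValue_rankZero_split_baseChange_anyPrime` (LNM 1716 §4, the passage following Thm. 4.1, pp. 111–112; D-audit
FAITHFUL-as-specialisation; rank-`0` slice = tree THEOREM `SteinWuthrich2013.clauses_rankZero_of_greenberg`, p662964); (2) GREENBERG's rank-`0`
formula at a NON-SPLIT multiplicative prime, INPUTS row G103 `Greenberg1999.thm41Analogue_charValue_rankZero_numberField` (§4 after Prop. 4.8,
pp. 112–113; FAITHFUL-as-weakening; slice p664420); (3) the EXCEPTIONAL-ZERO FORMULA at ODD primes `∀ W p, p ≠ 2 → greenberg_stevens`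
(Greenberg–Stevens 1993 for `p ≥ 5` ∕ Kobayashi 2006 Cor. 4.2 for odd `p`; read only at a SPLIT multiplicative `3`); (4) KATO 2004 Thm. 12.4
`Kato2004.thm12_4` (the `⊗ℚ` Euler-system divisibility outside the big-image locus); (5) MODULARITY "Version `L`" `exists_isNewformOf` (= the BODY
of route `PrintX11a`'s input item stmt-BirchSwinnertonDyer-19382); (6)–(8) KATO 2004 §17.13 construction facts V′ ∕ VI′ ∕ XI′ at `p ∥ N` in the
print-exact contragredient form `Kato2004.exists_multDivisibilityInputs_{nonsplit,split,fine}_contra`; (9) MAZUR 1978 Cor. 4.1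
`mazur_not_dvd_maninConstant_of_odd` (Manin constant prime to an odd `p` with `p² ∤ N`; feeds the analytic `μ₃ = 0` THEOREM
`MultThreeMuAn.muAnZeroAt_three_of_mult_of_irr`).  r7 displayed these as SEVEN single-fact stubs (`stub_newformFact` | `stub_maninOddFact` |
`stub_greenbergStevensOdd` | `stub_greenbergSplitRankZero` | `stub_greenbergNonsplitRankZero` | `stub_kato124Fact` | `stub_katoContraInputs`), kept
below as sorry-free PROJECTIONS of this stub so every consumer is byte-identical; r6 displayed the Stein–Wuthrich-typed nine.  Conjuncts (1)–(3), (5)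
are shared verbatim with L's birth r20 cite stub `Birth.stub_printInputsLower`; (5), (9) with U5's gl1cartan5 texts.  A bundle of named Literature
facts (never «proved» here; each conjunct closes by instantiation when its `_holds` lands — none exists: 0 unconditional `_holds` for any of the
nine, LEAD g14 ∕ g16 conclusion-position census; bench wave 2026-08-29T11:5xZ: `katoContraInputs`, `greenbergSplitRankZero` BLOCKED).
[cite: GreenbergLNM1716, §4, the passage following Thm. 4.1 (pp. 111–112) and the passage following Prop. 4.8 (pp. 112–113)]
[cite: GreenbergStevens1993, Thm. 3.14] [cite: Kobayashi2006DocMath, Cor. 4.2 (p. 575)] [cite: Kato2004Asterisque, Thm. 12.4 (p. 221), §17.13 (pp. 279–280)]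
[cite: BreuilConradDiamondTaylor2001, Thm. A] [cite: DiamondShurman2005, Thm. 8.8.3 (shape)] [cite: Mazur1978, Cor. 4.1] -/
theorem stub_printInputsUpperThree :
    Greenberg1999.thm41Analogue_charValue_rankZero_split_baseChange_anyPrime ∧
    Greenberg1999.thm41Analogue_charValue_rankZero_numberField ∧
    (∀ (W : WeierstrassCurve ℚ) [W.IsElliptic] [W.IsGloballyMinimal] (p : ℕ) [Fact p.Prime],
      p ≠ 2 → greenberg_stevens (W := W) (p := p)) ∧
    Kato2004.thm12_4 ∧
    exists_isNewformOf ∧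
    Kato2004.exists_multDivisibilityInputs_nonsplit_contra ∧
    Kato2004.exists_multDivisibilityInputs_split_contra ∧
    Kato2004.exists_multDivisibilityInputs_fine_contra ∧
    mazur_not_dvd_maninConstant_of_odd := by
  sorry

/-- **r7's `stub_newformFact` — since r8 a PROJECTION THEOREM (conjunct 5 of the cite stub `stub_printInputsUpperThree`; no `sorry` of its own)**:
MODULARITY "Version `L`", `exists_isNewformOf` = the BODY of route `PrintX11a`'s input item stmt-BirchSwinnertonDyer-19382 and the text of U5's
`GL1Cartan.stub_newform` ∕ L's `Birth.stub_newformFact`; conjunct 5 of the r6 nine: the newform `f_E`, its entire `L`-function, the parametrisation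
datum and the period ratio `ϖ`.  A named Literature fact (never «proved» here).
[cite: BreuilConradDiamondTaylor2001, Thm. A] [cite: DiamondShurman2005, Thm. 8.8.3 (shape)] -/
theorem stub_newformFact :
    exists_isNewformOf :=
  stub_printInputsUpperThree.2.2.2.2.1

/-- **r7's `stub_maninOddFact` — since r8 a PROJECTION THEOREM (conjunct 9 of the cite stub `stub_printInputsUpperThree`; no `sorry` of its own)**:
MAZUR 1978 Cor. 4.1, the Manin constant is prime to an odd `p` with `p² ∤ N`, `mazur_not_dvd_maninConstant_of_odd` = the text of U5's
`GL1Cartan.stub_maninOdd`; conjunct 9 of the r6 nine; feeds the analytic `μ₃ = 0` THEOREM `MultThreeMuAn.muAnZeroAt_three_of_mult_of_irr` (x11a-p2 g2,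
p614543) and Wuthrich's Cor. 18 at the pair.  A named Literature fact (never «proved» here).  [cite: Mazur1978, Cor. 4.1] -/
theorem stub_maninOddFact :
    mazur_not_dvd_maninConstant_of_odd :=
  stub_printInputsUpperThree.2.2.2.2.2.2.2.2

/-- **r7's `stub_greenbergStevensOdd` — since r8 a PROJECTION THEOREM (conjunct 3 of the cite stub `stub_printInputsUpperThree`; no `sorry` of its own)**:
the EXCEPTIONAL-ZERO FORMULA at ODD primes, Greenberg–Stevens 1993 ∕ Kobayashi 2006 Cor. 4.2, `∀ W p, p ≠ 2 → greenberg_stevens`; r6 slot 3 VERBATIM;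
= L's `Birth.stub_greenbergStevensOdd`; read by the engine ONLY at a SPLIT multiplicative `3`.  A named Literature fact (never «proved» here).
[cite: GreenbergStevens1993, Thm. 3.14] [cite: Kobayashi2006DocMath, Cor. 4.2 (p. 575)] -/
theorem stub_greenbergStevensOdd :
    ∀ (W : WeierstrassCurve ℚ) [W.IsElliptic] [W.IsGloballyMinimal] (p : ℕ) [Fact p.Prime],
      p ≠ 2 → greenberg_stevens (W := W) (p := p) :=
  stub_printInputsUpperThree.2.2.1

/-- **r7's `stub_greenbergSplitRankZero` — since r8 a PROJECTION THEOREM (conjunct 1 of the cite stub `stub_printInputsUpperThree`; no `sorry` of its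
own)**: GREENBERG's rank-`0` formula at a SPLIT multiplicative prime, INPUTS row G104
`Greenberg1999.thm41Analogue_charValue_rankZero_split_baseChange_anyPrime` (LNM 1716 §4 after Thm. 4.1, held PDF pp. 111–112, `l_v = 𝓛_p/(2p)`; D-audit
FAITHFUL-as-specialisation; = L's `Birth.stub_greenbergSplitRankZero`); replaces r6 conjunct 1 (Stein–Wuthrich 6.1 split), whose rank-`0` slice is the tree
THEOREM `SteinWuthrich2013.clauses_rankZero_of_greenberg` (p662964) from exactly this fact; read by
`X11b.le_padicValRat_of_split_divisibility_rankZero_noGZK_of_greenberg`.  A named Literature fact (never «proved» here).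
[cite: GreenbergLNM1716, §4, the passage following Thm. 4.1 (pp. 111–112)] -/
theorem stub_greenbergSplitRankZero :
    Greenberg1999.thm41Analogue_charValue_rankZero_split_baseChange_anyPrime :=
  stub_printInputsUpperThree.1

/-- **r7's `stub_greenbergNonsplitRankZero` — since r8 a PROJECTION THEOREM (conjunct 2 of the cite stub `stub_printInputsUpperThree`; no `sorry` of its
own)**: GREENBERG's rank-`0` formula at a NON-SPLIT multiplicative prime (`p` odd, `l_v ∼ 2`), INPUTS row G103
`Greenberg1999.thm41Analogue_charValue_rankZero_numberField` (LNM 1716 §4 after Prop. 4.8, held chunks p0112 ∕ p0113; D-audit FAITHFUL-as-weakening; = L's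
`Birth.stub_greenbergNonsplitRankZero`); replaces r6 conjunct 2 (Stein–Wuthrich 6.1 non-split), whose rank-`0` slice is the tree THEOREM
`SteinWuthrich2013.thm61_nonsplitMultiplicative_clauses_rankZero_of_greenberg` (p664420) from exactly this fact; read by
`X11b.le_padicValRat_of_nonsplit_divisibility_rankZero_noGZK_of_greenberg`.  A named Literature fact (never «proved» here).
[cite: GreenbergLNM1716, §4, the passage following Prop. 4.8 (pp. 112–113)] -/
theorem stub_greenbergNonsplitRankZero :
    Greenberg1999.thm41Analogue_charValue_rankZero_numberField :=
  stub_printInputsUpperThree.2.1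

/-- **r7's `stub_kato124Fact` — since r8 a PROJECTION THEOREM (conjunct 4 of the cite stub `stub_printInputsUpperThree`; no `sorry` of its own)**:
KATO 2004 Thm. 12.4, the Euler-system divisibility with `⊗ℚ` at the primes outside the big-image locus, `Kato2004.thm12_4`; conjunct 4 of the r6 nine;
the `⊗ℚ` divisibility that the μ₃-transfer turns integral (`X11b.multDivisibilityAt_three_of_not_surj_of_sixFacts`).  A named Literature fact (never
«proved» here).  [cite: Kato2004Asterisque, Thm. 12.4 (p. 221)] -/
theorem stub_kato124Fact :
    Kato2004.thm12_4 :=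
  stub_printInputsUpperThree.2.2.2.1

/-- **r7's `stub_katoContraInputs` — since r8 a PROJECTION THEOREM (conjuncts 6–8 of the cite stub `stub_printInputsUpperThree`; no `sorry` of its
own)**: KATO 2004 §17.13 construction facts V′ ∕ VI′ ∕ XI′ at `p ∥ N` in the print-exact contragredient form
(`exists_multDivisibilityInputs_{nonsplit,split,fine}_contra`, flag `Kato-1713-dual-action` print-exact per ARM-P; conjuncts 6–8 of the r6 nine): the
`p`-adic `L`-function ∕ Selmer-dual ∕ fine-sequence packages at a multiplicative prime.  Named Literature facts (never «proved» here).
[cite: Kato2004Asterisque, §17.13 (pp. 279–280)] -/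
theorem stub_katoContraInputs :
    Kato2004.exists_multDivisibilityInputs_nonsplit_contra ∧
      Kato2004.exists_multDivisibilityInputs_split_contra ∧
      Kato2004.exists_multDivisibilityInputs_fine_contra :=
  ⟨stub_printInputsUpperThree.2.2.2.2.2.1, stub_printInputsUpperThree.2.2.2.2.2.2.1,
    stub_printInputsUpperThree.2.2.2.2.2.2.2.1⟩

/-- **The r6 registered text `stub_nineFactsOddGS` (Stein–Wuthrich-typed nine) — LEFT the registered set at r7 (its road = tree glue p625569).**
This projection records what r7 keeps of it verbatim: conjuncts 3–9 (GS-odd, Kato 12.4,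
modularity, V′ ∕ VI′ ∕ XI′, Mazur 4.1) are r7 stubs BY TEXT; conjuncts 1–2 (SW 6.1 ×2) are replaced by G104 ∕ G103.  Pure logic.
[cite: SteinWuthrich2013, Thm. 6.1 (p. 20)] [cite: Kato2004Asterisque, §17.13 (pp. 279–280)] -/
theorem sevenOfNine_of_stubs :
    (∀ (W : WeierstrassCurve ℚ) [W.IsElliptic] [W.IsGloballyMinimal] (p : ℕ) [Fact p.Prime],
        p ≠ 2 → greenberg_stevens (W := W) (p := p)) ∧
      Kato2004.thm12_4 ∧ exists_isNewformOf ∧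
      Kato2004.exists_multDivisibilityInputs_nonsplit_contra ∧
      Kato2004.exists_multDivisibilityInputs_split_contra ∧
      Kato2004.exists_multDivisibilityInputs_fine_contra ∧ mazur_not_dvd_maninConstant_of_odd :=
  ⟨stub_greenbergStevensOdd, stub_kato124Fact, stub_newformFact, stub_katoContraInputs.1, stub_katoContraInputs.2.1,
    stub_katoContraInputs.2.2, stub_maninOddFact⟩

/-- **stub (the TRANSFER, `p`-generic) — LANDED (x11a-p2 g0, p606949), no `sorry`**: at an ODD prime of MULTIPLICATIVE
reduction with `E[p]` irreducible, statement (A) at the pair gives the INTEGRAL cyclotomic divisibility `X11b.MultDivisibilityAt`.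
[cite: Kato2004Asterisque, Thm. 12.5 (3) (p. 222), (14.9.3) (p. 240), §17.13 (pp. 279–280)] [cite: Wuthrich2014, Cor. 18 (p. 398)] -/
theorem stub_multDivisibilityAt_of_conjA :
    Kato2004.nonempty_iwasawaH1Data → Kato2004.thm12_4 →
    Kato2004.exists_multDivisibilityInputs_nonsplit → Kato2004.exists_multDivisibilityInputs_split →
    thm15_isTorsion_multiplicative_rat →
    Wuthrich2014.corollary18_padicLFunction_mem_iwasawaAlgebra_multiplicative →
    Kato2004.exists_multDivisibilityInputs_fine →
    ∀ (W : WeierstrassCurve ℚ) [W.IsElliptic] [W.IsGloballyMinimal] (p : ℕ) [Fact p.Prime],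
      p ≠ 2 → Mult W p → Irr W p → ConjAAt W p → MultDivisibilityAt W p :=
  Theorems.stub_multDivisibilityAt_of_conjA

/-- **stub (the μ-road's input) — r4/r6/r7: DISCHARGED modulo Mazur's fact (r7: `stub_maninOddFact`; r6: conjunct 9 of the nine)** by x11a-p2 g2's landed
`MultThreeMuAn.x11aNonSurjMuAnHardThree_of_mazur` (p614543: Greenberg's analytic μ₃ = 0 at a multiplicative 3 for irreducible
`E[3]`, Atkin–Lehner-extended orbit trick), fed Mazur's Manin-constant fact = conjunct 9 of the bundle.
[cite: GreenbergLNM1716, Conj. 1.11 (p. 62)] [cite: Mazur1978, Cor. 4.1] [cite: Kato2004Asterisque, §17.13 (pp. 279–280)] -/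
theorem stub_muAnHardThree : Theorems.X11aNonSurjMuAnHardThree :=
  Theorems.MultThreeMuAn.x11aNonSurjMuAnHardThree_of_mazur stub_maninOddFact

/-- **Road dominance (lead r2, real proof)**: the μ-road's input and four conjuncts of the bundle (modularity, Manin, Kato's fine
package at `p ∥ N`, Wuthrich Cor. 18) give the (A)-road's hard-locus input — the lead's landed
`UpperNonSurjThreeConjAOfMuAn.conjAHardThree_of_muAnHardThree` (p608976).
[cite: CoatesSujatha2005, §3 statement (A)] [cite: Kato2004Asterisque, §13.8 (p. 228) and §17.13 (pp. 279–280)] -/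
theorem stub_conjA_hardThree_of_muAnHardThree (hF : Theses.ErratumRoadFive.KatoTwinFactsFiveAn)
    (hμ : Theorems.X11aNonSurjMuAnHardThree) :
    ∀ (W : WeierstrassCurve ℚ) [W.IsElliptic] [W.IsGloballyMinimal] (p : ℕ) [Fact p.Prime],
      ClassX11a W p → ¬ Surj W p → p = 3 →
      (W.HasSplitMultiplicativeReductionAtPrime p ∨
        ∀ t : ℚ, W.entireLFunction 1 / (W.realPeriodRat : ℂ) = (t : ℂ) → padicValRat p t ≠ 0) →
      ConjAAt W p := by
  obtain ⟨-, -, -, -, -, hNf, -, -, hM, -, -, -, -, -, -, -, -, -, -, -, -, h18, hfine⟩ := hF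
  exact Theorems.UpperNonSurjThreeConjAOfMuAn.conjAHardThree_of_muAnHardThree hNf hM hfine h18 hμ

/-- **stub (lead reshape r1: (A) on the HARD sub-locus) — r4: DISCHARGED modulo K2's bundle** (μ-road's input + dominance); r6: stated
CONDITIONALLY on the bundle `hF` (no longer a registered stub). [cite: CoatesSujatha2005, §3 statement (A) and Thm. 3.4] [cite: SteinWuthrich2013, Thm. 6.1 (p. 20)] -/
theorem stub_conjA_hardThree_of_pubFacts (hF : Theses.ErratumRoadFive.KatoTwinFactsFiveAn) :
    ∀ (W : WeierstrassCurve ℚ) [W.IsElliptic] [W.IsGloballyMinimal] (p : ℕ) [Fact p.Prime],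
      ClassX11a W p → ¬ Surj W p → p = 3 →
      (W.HasSplitMultiplicativeReductionAtPrime p ∨
        ∀ t : ℚ, W.entireLFunction 1 / (W.realPeriodRat : ℂ) = (t : ℂ) → padicValRat p t ≠ 0) →
      ConjAAt W p :=
  stub_conjA_hardThree_of_muAnHardThree hF stub_muAnHardThree

/-- **The two (A)-stubs are equivalent modulo the facts (lead r3, real proof)**: off the hard sub-locus the pair is non-split with
`ord_3(L(E,1)/Ω_E) = 0` and statement (A) holds OUTRIGHT by x11a-p3's `ClassX11a.conjAAt_of_muAnHard_of_not_surj` (p609537).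
[cite: CoatesSujatha2005, §3 statement (A)] [cite: MazurTateTeitelbaum1986, §I.10 (constant term at a_p = −1)] -/
theorem stub_conjA_three_of_conjA_hardThree (hF : Theses.ErratumRoadFive.KatoTwinFactsFiveAn)
    (hA : ∀ (W : WeierstrassCurve ℚ) [W.IsElliptic] [W.IsGloballyMinimal] (p : ℕ) [Fact p.Prime],
      ClassX11a W p → ¬ Surj W p → p = 3 →
      (W.HasSplitMultiplicativeReductionAtPrime p ∨
        ∀ t : ℚ, W.entireLFunction 1 / (W.realPeriodRat : ℂ) = (t : ℂ) → padicValRat p t ≠ 0) →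
      ConjAAt W p) :
    ∀ (W : WeierstrassCurve ℚ) [W.IsElliptic] [W.IsGloballyMinimal] (p : ℕ) [Fact p.Prime],
      ClassX11a W p → ¬ Surj W p → p = 3 → ConjAAt W p := by
  obtain ⟨-, -, -, -, hmod, -, hpar, -, -, -, -, -, -, -, -, -, -, -, -, -, -, h18, hfine⟩ := hF
  intro W _ _ p _ hX hns hp3
  by_cases hhard : W.HasSplitMultiplicativeReductionAtPrime p ∨
      ∀ t : ℚ, W.entireLFunction 1 / (W.realPeriodRat : ℂ) = (t : ℂ) → padicValRat p t ≠ 0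
  · exact hA W p hX hns hp3 hhard
  · exact hX.conjAAt_of_muAnHard_of_not_surj hfine h18 hpar hmod hns (fun h => absurd h hhard)

/-- **stub (load-bearing input of the (A)-road: Coates–Sujatha's statement (A) on the U3 domain) — r4: DISCHARGED modulo
K2's bundle** ((A)-hard + the unit-value complement); r6: stated CONDITIONALLY on the bundle `hF`.  Class-wide it is an Iwasawa-μ statement for ℚ(E[3])·ℚ_cyc; here it
follows from the analytic μ₃ = 0 theorem p614543 through Kato's fine sequence.
[cite: CoatesSujatha2005, §3 statement (A) and Thm. 3.4] [cite: DeoRaySujatha2023, Thm. 3.9 (b) and Lemma 5.1 (arXiv:2202.09937 pp. 9–10, 17)] -/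
theorem stub_conjA_three_of_pubFacts (hF : Theses.ErratumRoadFive.KatoTwinFactsFiveAn) :
    ∀ (W : WeierstrassCurve ℚ) [W.IsElliptic] [W.IsGloballyMinimal] (p : ℕ) [Fact p.Prime],
      ClassX11a W p → ¬ Surj W p → p = 3 → ConjAAt W p :=
  stub_conjA_three_of_conjA_hardThree hF (stub_conjA_hardThree_of_pubFacts hF)

/-- The whole-domain (A)-stub implies the hard-locus (A)-stub (drop the locus hypothesis). Pure logic.
[cite: CoatesSujatha2005, §3 statement (A)] -/
theorem stub_conjA_hardThree_of_conjA_three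
    (h : ∀ (W : WeierstrassCurve ℚ) [W.IsElliptic] [W.IsGloballyMinimal] (p : ℕ) [Fact p.Prime],
      ClassX11a W p → ¬ Surj W p → p = 3 → ConjAAt W p) :
    ∀ (W : WeierstrassCurve ℚ) [W.IsElliptic] [W.IsGloballyMinimal] (p : ℕ) [Fact p.Prime],
      ClassX11a W p → ¬ Surj W p → p = 3 →
      (W.HasSplitMultiplicativeReductionAtPrime p ∨
        ∀ t : ℚ, W.entireLFunction 1 / (W.realPeriodRat : ℂ) = (t : ℂ) → padicValRat p t ≠ 0) →
      ConjAAt W p :=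
  fun W _ _ p _ hX hns hp3 _ => h W p hX hns hp3

/-! ## r7 ∕ r8: THE composition of record — the crux from the seven single-fact names, Greenberg-typed (real proof; byte-identical at r8, where the seven names are PROJECTIONS of the ONE cite stub `stub_printInputsUpperThree`, the only `sorry` in its cone) -/

/-- **Composition (r7)**: the seven stubs ⟹ the crux BY NAME, through the lead's
`Theorems.GreenbergRankZero.upperNonSurjThree_of_greenberg_of_sevenFacts` (p672149): μ₃-road — analytic `μ₃ = 0` THEOREM
`MultThreeMuAn.muAnZeroAt_three_of_mult_of_irr` mod Mazur (`stub_maninOddFact`), Kato μ-transfer on the `_contra` packages (`stub_kato124Fact`,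
`stub_katoContraInputs`), Wuthrich Cor. 18 and Greenberg 1.5 at the pair, `rank E(ℚ) = 0` by the control theorem, then `#Ш[3^∞] < ∞` and the leading
term from GREENBERG's rank-`0` formula (`stub_greenbergSplitRankZero` ∕ `stub_greenbergNonsplitRankZero`, the INPUT seats' slices inside),
Greenberg–Stevens only at a split `3` (`stub_greenbergStevensOdd`), modularity (`stub_newformFact`); NO Stein–Wuthrich 6.1, NO GZK.
[cite: GreenbergLNM1716, §4, the passage following Thm. 4.1 (pp. 111–113)] [cite: Kato2004Asterisque, Thm. 12.4 (p. 221), §17.13 (pp. 279–280)]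
[cite: Mazur1978, Cor. 4.1] [cite: Kobayashi2006DocMath, Cor. 4.2 (p. 575)] -/
theorem UpperNonSurjThree_of : Theses.PrintX11a.UpperNonSurjThree := by
  obtain ⟨hns', hsp', hfine'⟩ := stub_katoContraInputs
  exact Theorems.GreenbergRankZero.upperNonSurjThree_of_greenberg_of_sevenFacts stub_greenbergSplitRankZero
    stub_greenbergNonsplitRankZero stub_greenbergStevensOdd stub_kato124Fact stub_newformFact hns' hsp' hfine' stub_maninOddFact

/-! ## Compositions of r1–r4 through K2's bundle (real proofs; r6: CONDITIONAL on `hF : KatoTwinFactsFiveAn`, sorry-free) -/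

/-- **Composition, (A)-road**: `stub_conjA_three` ⟹ (`stub_multDivisibilityAt_of_conjA`, fed the named facts unpacked from
the bundle `hF`) `MultDivisibilityAt` ⟹ (door `X11b.missingUpperBoundAt_of_classX11a_of_multDivisibilityAt`) the child crux BY NAME.
[cite: Kato2004Asterisque, §17.13 (pp. 279–280)] [cite: SteinWuthrich2013, Thm. 6.1 (p. 20)] -/
theorem UpperNonSurjThree_of_conjARoad (hF : Theses.ErratumRoadFive.KatoTwinFactsFiveAn) :
    Theses.PrintX11a.UpperNonSurjThree := by
  have hF' := hF
  obtain ⟨-, -, -, hGZK, hmod, -, hpar, -, -, -, -, hJs, hJn, hGS, -, -, hne, h12, hnsI, hspI, h15, h18,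
    hfine⟩ := hF'
  intro W _ _ p _ hX hns hp3
  exact missingUpperBoundAt_of_classX11a_of_multDivisibilityAt hJs hJn hGZK hmod hpar W p (hGS W p) hX
    (stub_multDivisibilityAt_of_conjA hne h12 hnsI hspI h15 h18 hfine W p hX.2.1 hX.2.2.1 hX.2.2.2.1
      (stub_conjA_three_of_pubFacts hF W p hX hns hp3))

/-- **Composition, μ-road** (verbatim from «hardlocus3»): split at `p` or anomalous value ⟹ `stub_muAnHardThree` ⟹
`multDivisibilityAt_of_katoFacts_of_muAn` ⟹ the door; non-split unit value ⟹ the landed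
`Theorems.x11a_missingUpperBoundAt_of_not_surj_of_nonsplit_of_unit_value`.
[cite: Kato2004Asterisque, §17.13 (pp. 279–280)] [cite: SteinWuthrich2013, Thm. 6.1 (p. 20)] -/
theorem UpperNonSurjThree_of_muRoad (hF : Theses.ErratumRoadFive.KatoTwinFactsFiveAn) :
    Theses.PrintX11a.UpperNonSurjThree := by
  have hF' := hF
  obtain ⟨-, -, -, hGZK, hmod, -, hpar, -, -, -, -, hJs, hJn, hGS, -, -, hne, h12, hnsI, hspI, h15, h18,
    hfine⟩ := hF'
  intro W _ _ p _ hX hns hp3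
  have hp2 : p ≠ 2 := hX.2.1
  by_cases hsplit : W.HasSplitMultiplicativeReductionAtPrime p
  · exact missingUpperBoundAt_of_classX11a_of_multDivisibilityAt hJs hJn hGZK hmod hpar W p (hGS W p) hX
      (multDivisibilityAt_of_katoFacts_of_muAn hne h12 hnsI hspI h15 h18 hfine W p hp2 hX.2.2.1
        hX.2.2.2.1 hns (stub_muAnHardThree W p hX hns hp3 (Or.inl hsplit)))
  · by_cases hunit : ∃ t : ℚ, W.entireLFunction 1 / (W.realPeriodRat : ℂ) = (t : ℂ) ∧ padicValRat p t = 0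
    · obtain ⟨t, ht, hu⟩ := hunit
      exact Theorems.x11a_missingUpperBoundAt_of_not_surj_of_nonsplit_of_unit_value hJs hJn hGZK hmod
        hpar hne h12 hnsI hspI h15 h18 hfine W p (hGS W p) hX hns hsplit t ht hu
    · have hhard : ∀ t : ℚ, W.entireLFunction 1 / (W.realPeriodRat : ℂ) = (t : ℂ) →
          padicValRat p t ≠ 0 := fun t ht hu => hunit ⟨t, ht, hu⟩
      exact missingUpperBoundAt_of_classX11a_of_multDivisibilityAt hJs hJn hGZK hmod hpar W p (hGS W p)
        hX (multDivisibilityAt_of_katoFacts_of_muAn hne h12 hnsI hspI h15 h18 hfine W p hp2 hX.2.2.1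
          hX.2.2.2.1 hns (stub_muAnHardThree W p hX hns hp3 (Or.inr hhard)))

/-- **Composition, (A)-road on the hard sub-locus** (lead r1). [cite: Kato2004Asterisque, §17.13 (pp. 279–280)]
[cite: SteinWuthrich2013, Thm. 6.1 (p. 20)] -/
theorem UpperNonSurjThree_of_conjAHard (hF : Theses.ErratumRoadFive.KatoTwinFactsFiveAn) :
    Theses.PrintX11a.UpperNonSurjThree := by
  have hF' := hF
  obtain ⟨-, -, -, hGZK, hmod, -, hpar, -, -, -, -, hJs, hJn, hGS, -, -, hne, h12, hnsI, hspI, h15, h18,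
    hfine⟩ := hF'
  intro W _ _ p _ hX hns hp3
  have hp2 : p ≠ 2 := hX.2.1
  by_cases hsplit : W.HasSplitMultiplicativeReductionAtPrime p
  · exact missingUpperBoundAt_of_classX11a_of_multDivisibilityAt hJs hJn hGZK hmod hpar W p (hGS W p) hX
      (stub_multDivisibilityAt_of_conjA hne h12 hnsI hspI h15 h18 hfine W p hp2 hX.2.2.1 hX.2.2.2.1
        (stub_conjA_hardThree_of_pubFacts hF W p hX hns hp3 (Or.inl hsplit)))
  · by_cases hunit : ∃ t : ℚ, W.entireLFunction 1 / (W.realPeriodRat : ℂ) = (t : ℂ) ∧ padicValRat p t = 0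
    · obtain ⟨t, ht, hu⟩ := hunit
      exact Theorems.x11a_missingUpperBoundAt_of_not_surj_of_nonsplit_of_unit_value hJs hJn hGZK hmod
        hpar hne h12 hnsI hspI h15 h18 hfine W p (hGS W p) hX hns hsplit t ht hu
    · have hhard : ∀ t : ℚ, W.entireLFunction 1 / (W.realPeriodRat : ℂ) = (t : ℂ) →
          padicValRat p t ≠ 0 := fun t ht hu => hunit ⟨t, ht, hu⟩
      exact missingUpperBoundAt_of_classX11a_of_multDivisibilityAt hJs hJn hGZK hmod hpar W p (hGS W p)
        hX (stub_multDivisibilityAt_of_conjA hne h12 hnsI hspI h15 h18 hfine W p hp2 hX.2.2.1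
          hX.2.2.2.1 (stub_conjA_hardThree_of_pubFacts hF W p hX hns hp3 (Or.inr hhard)))

/-! ## r6: the composition through the Stein–Wuthrich-typed nine — KEPT IN THE TREE, not restated here

The r6 registered text `stub_nineFactsOddGS` (SW 6.1 ×2 ∧ GS-odd ∧ Kato 12.4 ∧ modularity ∧ V′ ∧ VI′ ∧ XI′ ∧ Mazur 4.1) closes U3 through x11a-p2 g4's
LANDED glue `Summit.BirchSwinnertonDyer.BirchSwinnertonDyer.Theorems.upperNonSurjThree_of_nineFacts_oddGS_glue` (p625569, sorry-free, its hypothesis =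
that text VERBATIM), so a planner who files the SW-typed nine as ONE item still closes U3 by name; r7 loses no road.  (It is not restated in this
workfile because a theorem concluding the crux under an unregistered conjunction hypothesis would be read as the skeleton by the A12 audit.) -/

/-! ## r4: the crux MODULO THE FACT BUNDLE — sorry-free conditional theorem (the content of `Theorems/PrintX11aUpperNonSurjThree.lean`) -/

/-- **Crux U3 from K2's published-fact bundle alone (sorry-free, CONDITIONAL)**: `KatoTwinFactsFiveAn → UpperNonSurjThree`,
by the μ-road with x11a-p2 g2's analytic μ₃ = 0 theorem (p614543) as the certificate. Nothing asserted; the bundle's conjuncts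
are statement-only named facts. [cite: GreenbergLNM1716, Conj. 1.11] [cite: Kato2004Asterisque, §17.13 (pp. 279–280)]
[cite: SteinWuthrich2013, Thm. 6.1 (p. 20)] [cite: Mazur1978, Cor. 4.1] -/
theorem UpperNonSurjThree_of_pubFacts (hF : Theses.ErratumRoadFive.KatoTwinFactsFiveAn) :
    Theses.PrintX11a.UpperNonSurjThree := by
  obtain ⟨-, -, -, hGZK, hmod, -, hpar, -, hM, -, -, hJs, hJn, hGS, -, -, hne, h12, hnsI, hspI, h15, h18,
    hfine⟩ := hF
  have hμ : Theorems.X11aNonSurjMuAnHardThree := Theorems.MultThreeMuAn.x11aNonSurjMuAnHardThree_of_mazur hM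
  intro W _ _ p _ hX hns hp3
  have hp2 : p ≠ 2 := hX.2.1
  by_cases hsplit : W.HasSplitMultiplicativeReductionAtPrime p
  · exact missingUpperBoundAt_of_classX11a_of_multDivisibilityAt hJs hJn hGZK hmod hpar W p (hGS W p) hX
      (multDivisibilityAt_of_katoFacts_of_muAn hne h12 hnsI hspI h15 h18 hfine W p hp2 hX.2.2.1
        hX.2.2.2.1 hns (hμ W p hX hns hp3 (Or.inl hsplit)))
  · by_cases hunit : ∃ t : ℚ, W.entireLFunction 1 / (W.realPeriodRat : ℂ) = (t : ℂ) ∧ padicValRat p t = 0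
    · obtain ⟨t, ht, hu⟩ := hunit
      exact Theorems.x11a_missingUpperBoundAt_of_not_surj_of_nonsplit_of_unit_value hJs hJn hGZK hmod
        hpar hne h12 hnsI hspI h15 h18 hfine W p (hGS W p) hX hns hsplit t ht hu
    · have hhard : ∀ t : ℚ, W.entireLFunction 1 / (W.realPeriodRat : ℂ) = (t : ℂ) →
          padicValRat p t ≠ 0 := fun t ht hu => hunit ⟨t, ht, hu⟩
      exact missingUpperBoundAt_of_classX11a_of_multDivisibilityAt hJs hJn hGZK hmod hpar W p (hGS W p)
        hX (multDivisibilityAt_of_katoFacts_of_muAn hne h12 hnsI hspI h15 h18 hfine W p hp2 hX.2.2.1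
          hX.2.2.2.1 hns (hμ W p hX hns hp3 (Or.inr hhard)))

end Summit.BirchSwinnertonDyer.BirchSwinnertonDyer.Cruxes.UpperNonSurjThree.FineMu

end
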